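import Summits.AtomisticToContinuum.BoseEinsteinCondensation.Theorems.GaussianDominationCan.Negative.CruxForms
import Literature.MathematicalPhysics.QuantumManyBody.LangevinGenerator
import Literature.Topology.FourManifolds.RadialStretch

/-!
# Crux `FibreConductance` — one-dimensional profiles of the two-slab witness

* the smooth step `Real.smoothTransition`: a GLOBAL slope bound `|sT'| ≤ K`
  (`exists_bound_deriv_smoothTransition`; the vanishing of `sT'` off `[0,1]` is reused from
  `Literature.Topology.FourManifolds.RadialStretch`);
* the angle `θ = 2πt/L`, the barrier indicator `b = sT(2cos 2θ)`, the two-slab profile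
  `g = 1 - (1-σ)b` (`= σ` on `{|sin θ| ≤ 1/2}`, `= 1` on `[L/8, 3L/8]`, `L/2`-periodic, `C¹`,
  `|g'| ≤ 16πK/L`) and the chamber selector `f = sT(2 sin θ + 1/2)` (`C¹`, `L`-periodic,
  `|f'| ≤ 4πK/L`, and `f' ≠ 0 ⇒ |sin θ| ≤ 1/4`), whence the key pointwise bound
  `f'² g² ≤ (4πK/L)² σ²` (`deriv_testProfile_sq_mul_slabProfile_sq_le`).

Crux disprover file for `stmt-AtomisticToContinuum-9480` (route `BECThomsonPrinciple`, crux
`FibreConductance`); part of the chain `Profiles → OneDimAxis → (FibreVocabulary) → SlabState →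
TestFunction → NearMinimiserFalse` proving `not_fibreConductanceNearMinimiser`: the exact-minimiser
hypothesis (H1) of the crux cannot be relaxed to `δ`-near-minimality for any `δ > 0`.
All [folklore] (elementary real analysis).
-/

noncomputable section

namespace Summit.AtomisticToContinuum.BoseEinsteinCondensation.Theorems.FibreConductance.Negative

open MeasureTheory Literature.MathematicalPhysics.QuantumManyBody.BoseGas
open scoped ENNReal NNReal

/-! ### The smooth step (vanishing of `sT'` off `[0,1]` is reused from
`Literature.Topology.FourManifolds.RadialStretch`) -/

section SmoothStep

open Real

/-- The smooth step is `C¹`. [folklore] -/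
theorem contDiff_one_smoothTransition : ContDiff ℝ 1 smoothTransition :=
  smoothTransition.contDiff (n := 1)

/-- The smooth step is differentiable. [folklore] -/
theorem differentiable_smoothTransition : Differentiable ℝ smoothTransition :=
  contDiff_one_smoothTransition.differentiable one_ne_zero

/-- If the derivative of the smooth step does not vanish at `x` then `x ∈ [0, 1]`. [folklore] -/
theorem mem_Icc_of_deriv_smoothTransition_ne_zero {x : ℝ} (hx : deriv smoothTransition x ≠ 0) :
    x ∈ Set.Icc (0 : ℝ) 1 := by
  by_contra h
  rw [Set.mem_Icc, not_and_or, not_le, not_le] at h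
  rcases h with h | h
  · exact hx (Literature.Topology.FourManifolds.deriv_smoothTransition_of_neg h)
  · exact hx (Literature.Topology.FourManifolds.deriv_smoothTransition_of_one_lt h)

/-- **A global bound on the slope of the smooth step**: `|sT'| ≤ K` (continuity of `sT'` on the
compact `[0,1]`, and `sT' = 0` off it). [folklore] -/
theorem exists_bound_deriv_smoothTransition :
    ∃ K : ℝ, 1 ≤ K ∧ ∀ x, |deriv smoothTransition x| ≤ K := by
  have hc : Continuous (deriv smoothTransition) := contDiff_one_smoothTransition.continuous_deriv_one
  obtain ⟨C, hC⟩ := isCompact_Icc.exists_bound_of_continuousOn (s := Set.Icc (0 : ℝ) 1) hc.continuousOn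
  refine ⟨max C 1, le_max_right _ _, fun x => ?_⟩
  by_cases hx : deriv smoothTransition x = 0
  · rw [hx, abs_zero]; positivity
  · exact ((Real.norm_eq_abs _).symm.le.trans (hC x (mem_Icc_of_deriv_smoothTransition_ne_zero hx))).trans
      (le_max_left _ _)

end SmoothStep

/-! ### The one-dimensional profiles -/

section Profile

open Real

variable {L σ : ℝ}

/-- The angle `θ(t) = 2πt/L`. [folklore] -/
def ang (L t : ℝ) : ℝ := 2 * π * t / L

/-- The barrier indicator `b = sT(2 cos 2θ)`: `1` where `|sin θ| ≤ 1/2`, `0` where `cos 2θ ≤ 0`. [folklore] -/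
def barrier (L t : ℝ) : ℝ := smoothTransition (2 * cos (2 * ang L t))

/-- The two-slab profile `g = 1 - (1-σ) b`: equal to `σ` on the two barriers around `t = 0, L/2`
and to `1` on the two chambers around `t = L/4, 3L/4`. [folklore] -/
def slabProfile (L σ t : ℝ) : ℝ := 1 - (1 - σ) * barrier L t

/-- The chamber selector `f = sT(2 sin θ + 1/2)`: `1` on the chamber around `L/4`, `0` on the
chamber around `3L/4`, varying only inside the barriers. [folklore] -/
def testProfile (L t : ℝ) : ℝ := smoothTransition (2 * sin (ang L t) + 1 / 2)

/-- `0 ≤ b`. [folklore] -/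
theorem barrier_nonneg (L t : ℝ) : 0 ≤ barrier L t := smoothTransition.nonneg _
/-- `b ≤ 1`. [folklore] -/
theorem barrier_le_one (L t : ℝ) : barrier L t ≤ 1 := smoothTransition.le_one _

/-- `cos 2θ = 1 - 2 sin² θ`. [folklore] -/
theorem cos_two_mul_eq_one_sub (x : ℝ) : cos (2 * x) = 1 - 2 * sin x ^ 2 := by
  rw [cos_two_mul, cos_sq']; ring

/-- On `{|sin θ| ≤ 1/2}` the barrier indicator is `1`. [folklore] -/
theorem barrier_eq_one {L t : ℝ} (h : |sin (ang L t)| ≤ 1 / 2) : barrier L t = 1 := by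
  unfold barrier
  apply smoothTransition.one_of_one_le
  rw [cos_two_mul_eq_one_sub]
  have h2 : sin (ang L t) ^ 2 ≤ 1 / 4 := by
    have := (sq_le_sq' (by linarith [abs_le.mp h |>.1]) (abs_le.mp h).2)
    nlinarith [abs_nonneg (sin (ang L t)), sq_abs (sin (ang L t))]
  linarith

/-- `σ ≤ g ≤ 1` for `σ ∈ [0,1]`. [folklore] -/
theorem slabProfile_mem (hσ1 : σ ≤ 1) (L t : ℝ) :
    σ ≤ slabProfile L σ t ∧ slabProfile L σ t ≤ 1 := by
  unfold slabProfile
  have h0 := barrier_nonneg L t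
  have h1 := barrier_le_one L t
  constructor <;> nlinarith

/-- `g > 0` for `σ ∈ (0, 1]`. [folklore] -/
theorem slabProfile_pos (hσ0 : 0 < σ) (hσ1 : σ ≤ 1) (L t : ℝ) : 0 < slabProfile L σ t :=
  hσ0.trans_le (slabProfile_mem hσ1 L t).1

/-- On the barriers `{|sin θ| ≤ 1/2}` the profile equals `σ`. [folklore] -/
theorem slabProfile_eq_of_abs_sin_le {L t : ℝ} (h : |sin (ang L t)| ≤ 1 / 2) :
    slabProfile L σ t = σ := by
  unfold slabProfile; rw [barrier_eq_one h]; ring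

/-- On the chamber `[L/8, 3L/8]` the profile equals `1`. [folklore] -/
theorem slabProfile_eq_one (hL : 0 < L) {t : ℝ} (ht : t ∈ Set.Icc (L / 8) (3 * L / 8)) :
    slabProfile L σ t = 1 := by
  unfold slabProfile barrier
  have hcos : cos (2 * ang L t) ≤ 0 := by
    apply cos_nonpos_of_pi_div_two_le_of_le
    · unfold ang
      rw [show π / 2 = 2 * (2 * π * (L / 8) / L) by field_simp; ring]
      gcongr
      exact ht.1
    · unfold ang
      rw [show π + π / 2 = 2 * (2 * π * (3 * L / 8) / L) by field_simp; ring]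
      gcongr
      exact ht.2
  rw [smoothTransition.zero_of_nonpos (by linarith)]
  ring

/-- `g` is `L/2`-periodic (hence `L`-periodic). [folklore] -/
theorem slabProfile_add_half (hL : L ≠ 0) (σ t : ℝ) :
    slabProfile L σ (t + L / 2) = slabProfile L σ t := by
  unfold slabProfile barrier ang
  have : 2 * (2 * π * (t + L / 2) / L) = 2 * (2 * π * t / L) + 2 * π := by field_simp
  rw [this, cos_add_two_pi]

/-- `g` is `L`-periodic. [folklore] -/
theorem slabProfile_add_period (hL : L ≠ 0) (σ t : ℝ) :
    slabProfile L σ (t + L) = slabProfile L σ t := by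
  have h := slabProfile_add_half hL σ (t + L / 2)
  rw [show t + L / 2 + L / 2 = t + L by ring] at h
  rw [h, slabProfile_add_half hL]

/-- `0 ≤ f ≤ 1`. [folklore] -/
theorem testProfile_mem (L t : ℝ) : 0 ≤ testProfile L t ∧ testProfile L t ≤ 1 :=
  ⟨smoothTransition.nonneg _, smoothTransition.le_one _⟩

/-- `f = 1` where `sin θ ≥ 1/4`. [folklore] -/
theorem testProfile_eq_one {L t : ℝ} (h : 1 / 4 ≤ sin (ang L t)) : testProfile L t = 1 :=
  smoothTransition.one_of_one_le (by linarith)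

/-- `f = 0` where `sin θ ≤ -1/4`. [folklore] -/
theorem testProfile_eq_zero {L t : ℝ} (h : sin (ang L t) ≤ -(1 / 4)) : testProfile L t = 0 :=
  smoothTransition.zero_of_nonpos (by linarith)

/-- `f` is `L`-periodic. [folklore] -/
theorem testProfile_add_period (hL : L ≠ 0) (t : ℝ) :
    testProfile L (t + L) = testProfile L t := by
  unfold testProfile ang
  have : 2 * π * (t + L) / L = 2 * π * t / L + 2 * π := by field_simp
  rw [this, sin_add_two_pi]

/-! #### Derivatives -/

/-- `θ'(t) = 2π/L`. [folklore] -/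
theorem hasDerivAt_ang (L t : ℝ) : HasDerivAt (ang L) (2 * π / L) t := by
  unfold ang
  have := ((hasDerivAt_id t).const_mul (2 * π)).div_const L
  simpa using this

/-- Chain rule for `b = sT(2 cos 2θ)`. [folklore] -/
theorem hasDerivAt_barrier (L t : ℝ) :
    HasDerivAt (barrier L)
      (deriv smoothTransition (2 * cos (2 * ang L t)) *
        (2 * (-sin (2 * ang L t) * (2 * (2 * π / L))))) t := by
  unfold barrier
  have h1 : HasDerivAt (fun t => 2 * ang L t) (2 * (2 * π / L)) t := (hasDerivAt_ang L t).const_mul 2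
  have h2 : HasDerivAt (fun t => cos (2 * ang L t)) (-sin (2 * ang L t) * (2 * (2 * π / L))) t :=
    (hasDerivAt_cos _).comp t h1
  have h3 : HasDerivAt (fun t => 2 * cos (2 * ang L t)) (2 * (-sin (2 * ang L t) * (2 * (2 * π / L)))) t :=
    h2.const_mul 2
  exact (differentiable_smoothTransition _).hasDerivAt.comp t h3

/-- Chain rule for `g = 1 - (1-σ) b`. [folklore] -/
theorem hasDerivAt_slabProfile (L σ t : ℝ) :
    HasDerivAt (slabProfile L σ)
      (-((1 - σ) * (deriv smoothTransition (2 * cos (2 * ang L t)) *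
        (2 * (-sin (2 * ang L t) * (2 * (2 * π / L))))))) t := by
  unfold slabProfile
  have h := ((hasDerivAt_barrier L t).const_mul (1 - σ)).const_sub 1
  simpa using h

/-- Chain rule for `f = sT(2 sin θ + 1/2)`. [folklore] -/
theorem hasDerivAt_testProfile (L t : ℝ) :
    HasDerivAt (testProfile L)
      (deriv smoothTransition (2 * sin (ang L t) + 1 / 2) * (2 * (cos (ang L t) * (2 * π / L)))) t := by
  unfold testProfile
  have h1 : HasDerivAt (fun t => sin (ang L t)) (cos (ang L t) * (2 * π / L)) t :=
    (hasDerivAt_sin _).comp t (hasDerivAt_ang L t)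
  have h2 : HasDerivAt (fun t => 2 * sin (ang L t) + 1 / 2) (2 * (cos (ang L t) * (2 * π / L))) t :=
    (h1.const_mul 2).add_const _
  exact (differentiable_smoothTransition _).hasDerivAt.comp t h2

/-- `θ` is `C¹`. [folklore] -/
theorem contDiff_ang (L : ℝ) : ContDiff ℝ 1 (ang L) := by
  unfold ang; fun_prop

/-- `g` is `C¹`. [folklore] -/
theorem contDiff_slabProfile (L σ : ℝ) : ContDiff ℝ 1 (slabProfile L σ) := by
  unfold slabProfile barrier
  have h : ContDiff ℝ 1 (fun t => 2 * cos (2 * ang L t)) := by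
    have := contDiff_ang L
    fun_prop
  exact contDiff_const.sub (contDiff_const.mul (contDiff_one_smoothTransition.comp h))

/-- `f` is `C¹`. [folklore] -/
theorem contDiff_testProfile (L : ℝ) : ContDiff ℝ 1 (testProfile L) := by
  unfold testProfile
  have h : ContDiff ℝ 1 (fun t => 2 * sin (ang L t) + 1 / 2) := by
    have := contDiff_ang L
    fun_prop
  exact contDiff_one_smoothTransition.comp h

/-- **Slope of the profile**: `|g'| ≤ 16πK/L`. [folklore] -/
theorem abs_deriv_slabProfile_le (hL : 0 < L) (hσ0 : 0 ≤ σ) (hσ1 : σ ≤ 1) {K : ℝ}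
    (hK : ∀ x, |deriv smoothTransition x| ≤ K) (t : ℝ) :
    |deriv (slabProfile L σ) t| ≤ 16 * π * K / L := by
  rw [(hasDerivAt_slabProfile L σ t).deriv, abs_neg, abs_mul, abs_mul]
  have h1 : |1 - σ| ≤ 1 := by rw [abs_of_nonneg (by linarith)]; linarith
  have h2 := hK (2 * cos (2 * ang L t))
  have h3 : |2 * (-sin (2 * ang L t) * (2 * (2 * π / L)))| ≤ 8 * π / L := by
    rw [abs_mul, abs_mul, abs_neg, abs_of_pos (by positivity : (0:ℝ) < 2),
      abs_of_pos (by positivity : (0:ℝ) < 2 * (2 * π / L))]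
    have := abs_sin_le_one (2 * ang L t)
    calc 2 * (|sin (2 * ang L t)| * (2 * (2 * π / L))) ≤ 2 * (1 * (2 * (2 * π / L))) := by gcongr
      _ = 8 * π / L := by ring
  have hK0 : 0 ≤ K := (abs_nonneg _).trans (hK 0)
  calc |1 - σ| * (|deriv smoothTransition (2 * cos (2 * ang L t))| *
        |2 * (-sin (2 * ang L t) * (2 * (2 * π / L)))|)
      ≤ 1 * (K * (8 * π / L)) := by gcongr
    _ = 16 * π * K / L / 2 := by ring
    _ ≤ 16 * π * K / L := by
        have : 0 ≤ 16 * π * K / L := by positivity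
        linarith

/-- **Slope of the selector**: `|f'| ≤ 4πK/L`. [folklore] -/
theorem abs_deriv_testProfile_le (hL : 0 < L) {K : ℝ} (hK : ∀ x, |deriv smoothTransition x| ≤ K)
    (t : ℝ) : |deriv (testProfile L) t| ≤ 4 * π * K / L := by
  rw [(hasDerivAt_testProfile L t).deriv, abs_mul]
  have h2 := hK (2 * sin (ang L t) + 1 / 2)
  have h3 : |2 * (cos (ang L t) * (2 * π / L))| ≤ 4 * π / L := by
    rw [abs_mul, abs_mul, abs_of_pos (by positivity : (0:ℝ) < 2),
      abs_of_pos (by positivity : (0:ℝ) < 2 * π / L)]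
    have := abs_cos_le_one (ang L t)
    calc 2 * (|cos (ang L t)| * (2 * π / L)) ≤ 2 * (1 * (2 * π / L)) := by gcongr
      _ = 4 * π / L := by ring
  have hK0 : 0 ≤ K := (abs_nonneg _).trans (hK 0)
  calc |deriv smoothTransition (2 * sin (ang L t) + 1 / 2)| * |2 * (cos (ang L t) * (2 * π / L))|
      ≤ K * (4 * π / L) := by gcongr
    _ = 4 * π * K / L := by ring

/-- **The selector varies only inside the barriers**: if `f'(t) ≠ 0` then `|sin θ(t)| ≤ 1/4`. [folklore] -/
theorem abs_sin_le_of_deriv_testProfile_ne_zero {L t : ℝ} (h : deriv (testProfile L) t ≠ 0) :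
    |sin (ang L t)| ≤ 1 / 4 := by
  rw [(hasDerivAt_testProfile L t).deriv] at h
  have h1 : deriv smoothTransition (2 * sin (ang L t) + 1 / 2) ≠ 0 := fun h0 => h (by rw [h0, zero_mul])
  have h2 := mem_Icc_of_deriv_smoothTransition_ne_zero h1
  rw [abs_le]
  constructor <;> linarith [h2.1, h2.2]

/-- **Key pointwise bound**: `f'(t)² g(t)² ≤ (4πK/L)² σ²` everywhere. [folklore] -/
theorem deriv_testProfile_sq_mul_slabProfile_sq_le (hL : 0 < L)
    {K : ℝ} (hK : ∀ x, |deriv smoothTransition x| ≤ K) (t : ℝ) :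
    deriv (testProfile L) t ^ 2 * slabProfile L σ t ^ 2 ≤ (4 * π * K / L) ^ 2 * σ ^ 2 := by
  by_cases h : deriv (testProfile L) t = 0
  · rw [h]; simp only [ne_eq, OfNat.ofNat_ne_zero, not_false_eq_true, zero_pow, zero_mul]; positivity
  · have hs := abs_sin_le_of_deriv_testProfile_ne_zero h
    rw [slabProfile_eq_of_abs_sin_le (σ := σ) (hs.trans (by norm_num))]
    have h1 := abs_deriv_testProfile_le hL hK t
    have h2 : deriv (testProfile L) t ^ 2 ≤ (4 * π * K / L) ^ 2 := by
      rw [← sq_abs]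
      exact pow_le_pow_left₀ (abs_nonneg _) h1 2
    exact mul_le_mul_of_nonneg_right h2 (sq_nonneg _)

end Profile


open Literature.MathematicalPhysics.QuantumManyBody.BoseGas

end Summit.AtomisticToContinuum.BoseEinsteinCondensation.Theorems.FibreConductance.Negative

end
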